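import Literature.AnabelianGeometry.EtaleTheta.LogDivisorModelTateTowerThetaTwistTowerRootLaw
import Literature.AnabelianGeometry.EtaleTheta.LogDivisorModelTateTowerKummerTwistCompatRShearTempered
import Literature.AnabelianGeometry.EtaleTheta.Discharge.Sec4GaloisLiftOfFullEssSurj
import HarnessLib

/-!
# [EtTh] Def. 4.1 (ii) / Prop. 4.2 (iii): A10 `BaseRootLaw` over the ε-free (β) Kummer tower `towerC₃sf` of the `Ÿ`-skeleton —
# E2 (a) AND «`IG := Galois`» DISCHARGED for every tempered Frobenioid with full essentially surjective base (Tate tower v3, 2c)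

S. Mochizuki, *The étale theta function and its Frobenioid-theoretic manifestations*, Publ. RIMS **45** (2009) [MochizukiEtTh2009],
Def. 3.3 (iii) p.73, Def. 4.1 (i)(ii) p.86 («`D = D₀[𝒟] → D₀`»), Prop. 4.2 (iii) p.89; [SemiAnbd] Def. 3.1 (i) / Rmk. 3.1.3 p.33;
ERRATUM E2 = [IUTchI] Rmk. 3.2.4 (i)(a) [cite: MochizukiEtTh2009, Prop 4.2 (iii) p.89].

abc-iut cell, layer L2 [EtTh]; PROOF-ONLY sequel (0 definitions) of the 2c plan's FILE 4 (seat abc-iut-L2-d2 gen 7 ON LOAN to the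
abc-iut-L2-t3 lineage, abc-iut-L2-lead gen 7 R1021); the EXACT analogue over abc-iut-L2-t3's ε-free theta tower `towerC₃sf`
(p488792) of this lineage's `TateTowerKummerTwist.baseRootLaw_top_towerC_of_full_essSurj` / `baseRootLaw_galois_towerC_of_full_essSurj`
(p481604 / p482079, the chain-only ζ-twisted tower).  Consumed BY NAME: abc-iut-L2-t3's `rootLawC₃sf` (E2 (a) on `towerC₃sf`,
p490708), abc-iut-L1-t6's `TateTowerKummerTwistRShear.isTemperedC` (`Compat 3 thetaShear` is tempered, p483372), abc-iut-L2-t3's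
lifting lemmas `baseRootLaw_top/galois_of_rootLaw_of_full_essSurj` (`Sec4GaloisLiftOfFullEssSurj`).
* `baseRootLaw_top_towerC₃sf_of_full_essSurj` — A10 `BaseRootLaw ⊤` for EVERY tempered Frobenioid over the type-`ℤ` weak realified data
  of `DivisorMonoids.ofTower towerC₃sf` whose base functor is full and essentially surjective, with NO E2 hypothesis;
* `baseRootLaw_galois_towerC₃sf_of_full_essSurj` — the Def. 4.1 (ii) form `IG := «Galois»` (dominate by a Galois covering first:
  `Compat 3 thetaShear` is tempered), NO E2 / temperedness hypothesis.
The instantiation at the FULL-base tempered Frobenioid `ThetaTwistTowerTempered.temperedFrobenioid` (base `𝟭`, FILE 4, p493549) is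
a one-line corollary filed with that file's acceptance.  HONEST FRAMING: class-(b) design model, NOT the tempered tower of a Tate curve;
the (β) deviation of record (torsion sign of Prop. 1.4 (ii) not carried) stands; nothing here bears on [IUTchIII] Cor. 3.12; no side
taken; typed ≠ proved.
-/

noncomputable section

namespace Literature.AnabelianGeometry.EtaleTheta

open CategoryTheory Opposite Function Literature.AlgebraicGeometry.Frobenioids Literature.AlgebraicGeometry.Frobenioids.QuasiTemperoid
  Literature.AnabelianGeometry.SemiGraphs

namespace LogDivisorModel.TateTowerThetaTwist

open TateTowerKummerTwistRShear

universe u₀ v₀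

variable {hpf : ∀ Y : (ConnectedPart (BTemp (Compat 3 thetaShear)))ᵒᵖ, IsPerfFactorialCof ((DivisorMonoids.ofTower towerC₃sf).Φ₀.obj Y)}
  {D : Type u₀} [Category.{v₀} D] {VD : FrdICatStub.{u₀, v₀, 0} D}

/-- **A10 `BaseRootLaw ⊤` over the ε-free theta tower, NO E2 hypothesis**: for every tempered Frobenioid over the type-`ℤ` weak
realified data of `ofTower towerC₃sf` (any `hpf` slot) whose base functor is full and essentially surjective, every object's base admits
the root-lift property of Def. 4.1 (ii) — abc-iut-L2-t3's lifting lemma fed with `rootLawC₃sf`. [cite: MochizukiEtTh2009, Prop 4.2 (iii) p.89] -/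
theorem baseRootLaw_top_towerC₃sf_of_full_essSurj
    (tf : TemperedFrobenioid (RealifiedDivisorMonoids.ofRlfZWeak (DivisorMonoids.ofTower towerC₃sf) hpf) D VD)
    [tf.base.Full] [tf.base.EssSurj] : tf.BaseRootLaw fun _ => True :=
  tf.baseRootLaw_top_of_rootLaw_of_full_essSurj rootLawC₃sf

/-- **A10 with `IG := «Galois»` (Def. 4.1 (ii)) over the ε-free theta tower, NO E2 and NO temperedness hypothesis**: `Compat 3 thetaShear`
is tempered (abc-iut-L1-t6's `isTemperedC`), so every covering is dominated by a Galois one and the root lift lands in a Galois object.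
[cite: MochizukiEtTh2009, Prop 4.2 (iii) p.89] -/
theorem baseRootLaw_galois_towerC₃sf_of_full_essSurj
    (tf : TemperedFrobenioid (RealifiedDivisorMonoids.ofRlfZWeak (DivisorMonoids.ofTower towerC₃sf) hpf) D VD)
    [tf.base.Full] [tf.base.EssSurj] : tf.BaseRootLaw fun X => IsGaloisObj (tf.base.obj X).obj :=
  tf.baseRootLaw_galois_of_rootLaw_of_full_essSurj (isTemperedC 3 thetaShear) rootLawC₃sf

/-- **E2 (a) and temperedness TOGETHER on the 2c tower** (the two A10 inputs, both theorems): the root law of `ofTower towerC₃sf` and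
`IsTempered (Compat 3 thetaShear)`. [cite: MochizukiEtTh2009, Def 4.1 (ii) p.86] -/
theorem rootLaw_and_isTempered_towerC₃sf :
    (DivisorMonoids.ofTower towerC₃sf).RootLaw ∧ IsTempered (Compat 3 thetaShear) :=
  ⟨rootLawC₃sf, isTemperedC 3 thetaShear⟩

end LogDivisorModel.TateTowerThetaTwist

end Literature.AnabelianGeometry.EtaleTheta

end
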